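import Summits.Ventures.HodgeRepro2.T5InvariantMeasureUnique
import Summits.Ventures.HodgeRepro2.T5DiscreteCocompactDecomposition

/-!
# T5DecompositionInvariantMeasure — [DE] Theorem 9.2.2 for `L²(G ⧸ Γ, ν)`, `ν` ANY invariant measure

Cell pub-hodge-repro2, seat p5, Tier 5 (route/T5-N4-p5.md, N4.3 v13 (A3) STEP 1 / (B2)).  Rows 59 /
65 decompose `L²(G ⧸ Γ, μ_𝓕)` for the quotient measure of a fundamental domain; STEP 1 uses on
`Γ_i\G_∞` «the measure induced from G(𝔸)», [DE] p0234 l. 15 «its invariant Radon measure» — some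
`G`-invariant finite measure, normalised somehow.  Row 69 shows every such `ν` is `c • μ_𝓕`; this
file draws the consequence:

* `quotientMeasure_smul`: `c • μ_𝓕 = (c • μ)_𝓕` — the scalar multiple of the quotient measure is
  the quotient measure of the scaled Haar measure `c • μ` (same fundamental domain);
* `exists_decomposition_of_invariant`: **for EVERY nonzero `G`-invariant finite Borel measure `ν`
  on `G ⧸ Γ`, `L²(G ⧸ Γ, ν)` is the closed orthogonal sum of irreducible closed `G`-stable
  subspaces with every unitary-equivalence class FINITE** — `ν = (c • μ)_𝓕` with `c ≠ 0`, and
  `c • μ` is again a Haar measure, so row 59 applies verbatim.  Hypotheses: `G` locally compact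
  second countable Hausdorff, `Γ` discrete, `G ⧸ Γ` compact (with its Borel σ-algebra), `ν ≠ 0`.

Imports rows 59 / 62 / 64 / 65 / 69 and Mathlib.  Axioms: propext, Classical.choice, Quot.sound.
README §8(d): uses an L-value-free non-vanishing device: NO.
-/

namespace Summit.Ventures.HodgeRepro2.T5DecompositionInvariantMeasure

open MeasureTheory
open scoped NNReal
open Summit.Ventures.HodgeRepro2.T5RegularRep (regularRep)
open Summit.Ventures.HodgeRepro2.T5FiniteMultiplicity (IsUnitaryEquiv)
open Summit.Ventures.HodgeRepro2.T5CompactDiscreteDecomposition (IrreducibleOn)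

variable {G : Type*} [Group G] [TopologicalSpace G] [IsTopologicalGroup G] [T2Space G]
  [LocallyCompactSpace G] [SecondCountableTopology G] [MeasurableSpace G] [BorelSpace G]
  {Γ : Subgroup G} [DiscreteTopology Γ] [CompactSpace (G ⧸ Γ)]

attribute [-instance] Quotient.instMeasurableSpace

variable [MeasurableSpace (G ⧸ Γ)] [BorelSpace (G ⧸ Γ)]

omit [TopologicalSpace G] [IsTopologicalGroup G] [T2Space G] [LocallyCompactSpace G]
  [SecondCountableTopology G] [BorelSpace G] [DiscreteTopology Γ] [CompactSpace (G ⧸ Γ)]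
  [BorelSpace (G ⧸ Γ)] in
/-- `c • μ_𝓕 = (c • μ)_𝓕`: the scalar multiple of the quotient measure is the quotient measure of
the scaled measure. -/
theorem quotientMeasure_smul (μ : Measure G) (𝓕 : Set G) (c : ℝ≥0) :
    c • Measure.map (QuotientGroup.mk : G → G ⧸ Γ) (μ.restrict 𝓕) =
      Measure.map (QuotientGroup.mk : G → G ⧸ Γ) ((c • μ).restrict 𝓕) := by
  rw [Measure.restrict_smul, Measure.map_smul]

/-- **[DE] Theorem 9.2.2 for `L²(G ⧸ Γ, ν)` with `ν` ANY nonzero `G`-invariant finite Borel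
measure** on the compact quotient of a locally compact second countable Hausdorff group `G` by a
discrete subgroup `Γ`: `L²(G ⧸ Γ, ν)` is the closed orthogonal sum of irreducible closed
`G`-stable subspaces, every unitary-equivalence class of which is FINITE.  (`ν` is the quotient
measure of the Haar measure `c • μ`, row 69; row 59 applies to it.) -/
theorem exists_decomposition_of_invariant (ν : Measure (G ⧸ Γ)) [IsFiniteMeasure ν]
    [SMulInvariantMeasure G (G ⧸ Γ) ν] (hν : ν ≠ 0) :
    ∃ S : Set (Submodule ℂ (Lp ℂ 2 ν)),
      (∀ U ∈ S, IrreducibleOn (regularRep (G := G) ν) U) ∧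
      S.Pairwise (fun U V => U ⟂ V) ∧ (sSup S).topologicalClosure = ⊤ ∧
      ∀ U₀ ∈ S, {U ∈ S | IsUnitaryEquiv (regularRep (G := G) ν) U₀ U}.Finite := by
  let μ : Measure G := Measure.haar
  obtain ⟨𝓕, -, h𝓕⟩ := T5DiscreteCocompactDecomposition.exists_isFundamentalDomain_op Γ μ
  obtain ⟨c, hc⟩ := T5InvariantMeasureUnique.eq_smul_quotientMeasure ν μ h𝓕
  have hc0 : c ≠ 0 := by
    rintro rfl
    exact hν (by rw [hc, zero_smul])
  rw [quotientMeasure_smul] at hc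
  haveI : (c • μ).IsHaarMeasure :=
    Measure.IsHaarMeasure.smul μ (by simpa using hc0) ENNReal.coe_ne_top
  haveI : (c • μ).IsMulRightInvariant :=
    T5CocompactUnimodular.isMulRightInvariant_of_discrete_cocompact Γ (c • μ)
  haveI : (c • μ).IsInvInvariant :=
    T5SU11Unimodular.isInvInvariant_of_isMulRightInvariant_of_secondCountable (c • μ)
  haveI : Countable Γ := T5CocompactCovolume.countable_of_discreteTopology Γ
  have h𝓕' : IsFundamentalDomain Γ.op 𝓕 (c • μ) := h𝓕.mono Measure.smul_absolutelyContinuous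
  subst hc
  exact T5KernelIdentity.exists_decomposition_regularRep_quotient_of_discrete (c • μ) h𝓕'

end Summit.Ventures.HodgeRepro2.T5DecompositionInvariantMeasure
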